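import Summits.HodgeConjecture.HodgeConjecture.Theses.HeckePrymWeil
import Literature.AlgebraicGeometry.Motives.HyperbolicWeilType
import Literature.AlgebraicGeometry.Motives.HyperbolicWeilTypeOfRationalModel
import HarnessLib

/-!
# Split frame transport for the real-quadratic base change of a `ℚ(√-7)`-Weil sixfold

Route `HeckePrymWeil` of the Hodge summit, crux `WeilSixfoldsSqrtMinus7` (stmt-HodgeConjecture-1260),
line `real-quadratic-base-change`, stub `stub_splitFrameTransport`.

The line base-changes a `ℚ(√-7)`-Weil sixfold `A` to the 12-fold `B = A × A` carrying two commuting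
endomorphisms `ψ_K` (`ψ_K² = -7`) and `ψ_F` (`ψ_F² = t`). "Split `L`-Weil type" (`L = ℚ(√-7, √t)`) is
typed on the real carriers as a SPLIT FRAME: twelve rational, `ℂ`-independent classes
`u_i ∈ H¹(B(ℂ); ℂ)` spanning a `ψ_K^*`- and `ψ_F^*`-stable subspace, pairwise isotropic for the
polarization pairing `Q_{h,11}(x, y) = h¹¹ ⌣ x ⌣ y` (`Motives.polarizationPairingOne B.X h 11`).

This file proves the pure TRANSPORT step (van Geemen, LNM 1594, Lemma 5.2 (2)–(3) and 5.4 (5.4.1),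
read in coordinates): given a rational, `ℂ`-independent frame `w` (indexed by `Fin 12 ⊕ Fin 12`) in
which `ψ_K^*`, `ψ_F^*` have rational matrices `MM`, `ΨΨ` (columns = images) and `Q_{h,11}` has a
rational Gram matrix `GG` times a class `Ω`, together with twelve `ℚ`-independent coefficient vectors
`b_k` whose span is `MM.mulVec`- and `ΨΨ.mulVec`-stable and which are pairwise `GG`-isotropic, the
classes `u_k := Σ_s b_{k,s} • w_s` form a split frame.

The proof is the tree's `Motives.isHyperbolicWeilType_of_rationalModel`
(`Literature/AlgebraicGeometry/Motives/HyperbolicWeilTypeOfRationalModel`) with the stability block run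
twice (once for `ψ_K`/`MM`, once for `ψ_F`/`ΨΨ`); it reuses that file's public helpers
`sum_smul_sum_smul_eq` and `bilin_sum_smul_sum_smul`. Everything is proved; no definition and no named
fact is introduced.

## References

* [vanGeemen1994HodgeAV] B. van Geemen, An introduction to the Hodge conjecture for abelian
  varieties, LNM 1594 (1994), Lemma 5.2 (2)–(3), 5.4 (5.4.1).
* [HatcherAT2002] A. Hatcher, Algebraic Topology (2002), §3.1.
-/

noncomputable section
-- single-problem summit (Problem = Summit): the mandated namespace repeats `HodgeConjecture`.
set_option linter.dupNamespace false

open CategoryTheory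
open Literature.AlgebraicGeometry.Motives Literature.AlgebraicGeometry.HodgeTheory
open Literature.AlgebraicGeometry.Motives.AbelianVariety
open Literature.AlgebraicTopology.SingularHomology Literature.Geometry.Kaehler

namespace Summit.HodgeConjecture.HodgeConjecture.Theorems.WeilSixfoldsSqrtMinus7.RealQuadraticBaseChange

/-- **Split frame transport (model + isotropic stable coefficients ⇒ split frame; van Geemen 1994,
Lemma 5.2 (2)–(3) and 5.4 (5.4.1) read in coordinates, with TWO stabilising operators).**
On any complex abelian variety `B` with endomorphisms `ψ_K, ψ_F`, a class `h ∈ H²(B(ℂ); ℂ)` and a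
rational, `ℂ`-independent frame `w : Fin 12 ⊕ Fin 12 → H¹(B(ℂ); ℂ)` in which `ψ_K^*`, `ψ_F^*` have
rational matrices `MM`, `ΨΨ` (`ψ^* w_k = Σ_l M l k • w_l`) and `Q_{h,11}` has rational Gram matrix `GG`
(times a class `Ω`): twelve `ℚ`-independent coefficient vectors `b_k` spanning an `MM`- and
`ΨΨ`-stable subspace, pairwise `GG`-isotropic, give the classes `u_k = Σ_s b_{k,s} • w_s`, which are
rational (`IsRationalClass.sum_smul`), `ℂ`-independent (`linearIndependent_iff_of_isRationalClass`),
span a `ψ_K^*`- and `ψ_F^*`-stable subspace and are pairwise `Q_{h,11}`-isotropic (bilinearity of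
`polarizationPairingOne`). Verbatim the proof of the tree's `isHyperbolicWeilType_of_rationalModel`,
with the stability clause run twice.
[cite: vanGeemen1994HodgeAV, Lemma 5.2 (2)–(3) and 5.4 (5.4.1)] -/
theorem stub_splitFrameTransport :
    ∀ (B : AbelianVariety ℂ) (ψK ψF : B ⟶ B) (h : complexBetti B.X 2)
      (w : Fin 12 ⊕ Fin 12 → complexBetti B.X 1)
      (MM ΨΨ GG : Matrix (Fin 12 ⊕ Fin 12) (Fin 12 ⊕ Fin 12) ℚ) (Ω : complexBetti B.X (2 + 2 * 11)),
      (∀ k, IsRationalClass (w k)) → LinearIndependent ℂ w →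
      (∀ k, complexBetti.map ψK.hom.hom.hom 1 (w k) = ∑ l, ((MM l k : ℚ) : ℂ) • w l) →
      (∀ k, complexBetti.map ψF.hom.hom.hom 1 (w k) = ∑ l, ((ΨΨ l k : ℚ) : ℂ) • w l) →
      (∀ k l, polarizationPairingOne B.X h 11 (w k) (w l) = ((GG k l : ℚ) : ℂ) • Ω) →
      ∀ (b : Fin 12 → (Fin 12 ⊕ Fin 12) → ℚ), LinearIndependent ℚ b →
        (∀ k, ∃ c : Fin 12 → ℚ, MM.mulVec (b k) = ∑ l, c l • b l) →
        (∀ k, ∃ c : Fin 12 → ℚ, ΨΨ.mulVec (b k) = ∑ l, c l • b l) →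
        (∀ k l, ∑ s, ∑ s', b k s * GG s s' * b l s' = 0) →
        ∃ u : Fin 12 → complexBetti B.X 1,
          (∀ i, IsRationalClass (u i)) ∧ LinearIndependent ℂ u ∧
          (∀ i, complexBetti.map ψK.hom.hom.hom 1 (u i) ∈ Submodule.span ℂ (Set.range u)) ∧
          (∀ i, complexBetti.map ψF.hom.hom.hom 1 (u i) ∈ Submodule.span ℂ (Set.range u)) ∧
          ∀ i j, polarizationPairingOne B.X h 11 (u i) (u j) = 0 := by
  intro B ψK ψF h w MM ΨΨ GG Ω hw hind hMM hΨΨ hGG b hb hbM hbΨ hbG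
  classical
  -- the frame `u_k = Σ_s b_{k,s} • w_s`
  set v : Fin 12 → complexBetti B.X 1 := fun k => ∑ s, ((b k s : ℚ) : ℂ) • w s with hv
  have hv_rat : ∀ k, IsRationalClass (v k) := fun k => IsRationalClass.sum_smul Finset.univ hw (b k)
  -- stability under an endomorphism `ψ` with rational matrix `P` in the frame `w` whose `mulVec`
  -- stabilises the span of the `b_k`: `ψ^* v_k = Σ_j (P b_k)_j w_j = Σ_l c_l v_l` (used twice below)
  have hstab : ∀ (ψ : B ⟶ B) (P : Matrix (Fin 12 ⊕ Fin 12) (Fin 12 ⊕ Fin 12) ℚ),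
      (∀ k, complexBetti.map ψ.hom.hom.hom 1 (w k) = ∑ l, ((P l k : ℚ) : ℂ) • w l) →
      (∀ k, ∃ c : Fin 12 → ℚ, P.mulVec (b k) = ∑ l, c l • b l) →
      ∀ k, complexBetti.map ψ.hom.hom.hom 1 (v k) ∈ Submodule.span ℂ (Set.range v) := by
    intro ψ P hP hbP k
    obtain ⟨c, hc⟩ := hbP k
    have h1 : complexBetti.map ψ.hom.hom.hom 1 (v k) =
        ∑ j, ((P.mulVec (b k) j : ℚ) : ℂ) • w j := by
      simp only [hv, map_sum, map_smul, hP, Finset.smul_sum, smul_smul]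
      rw [Finset.sum_comm]
      refine Finset.sum_congr rfl fun j _ => ?_
      rw [← Finset.sum_smul, Matrix.mulVec, dotProduct]
      push_cast
      simp_rw [mul_comm (((b k _ : ℚ)) : ℂ)]
    have h2 : ∑ j, ((P.mulVec (b k) j : ℚ) : ℂ) • w j = ∑ l, ((c l : ℚ) : ℂ) • v l := by
      rw [hc, hv, sum_smul_sum_smul_eq]
      refine Finset.sum_congr rfl fun j _ => ?_
      congr 1
      simp only [Finset.sum_apply, Pi.smul_apply, smul_eq_mul, Rat.cast_sum, Rat.cast_mul]
    rw [h1, h2]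
    exact Submodule.sum_mem _ fun l _ => Submodule.smul_mem _ _ (Submodule.subset_span ⟨l, rfl⟩)
  refine ⟨v, hv_rat, ?_, hstab ψK MM hMM hbM, hstab ψF ΨΨ hΨΨ hbΨ, ?_⟩
  · -- `ℂ`-independence: a rational relation among the `v_k` is one among the `w_s`
    rw [linearIndependent_iff_of_isRationalClass hv_rat]
    intro q hq
    have hw' := (linearIndependent_iff_of_isRationalClass hw).1 hind
    have h1 : ∑ s, ((∑ k, q k * b k s : ℚ) : ℂ) • w s = 0 := by
      rw [← hq, hv, sum_smul_sum_smul_eq]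
      simp only [Rat.cast_sum, Rat.cast_mul]
    have h2 : (fun s => ∑ k, q k * b k s) = 0 := hw' _ h1
    -- `Σ_k q_k b_k = 0` in `(Fin 12 ⊕ Fin 12) → ℚ`, so `q = 0` by the `ℚ`-independence of `b`
    have h3 : ∑ k, q k • b k = 0 := by
      funext s
      simpa [Finset.sum_apply, Pi.smul_apply, smul_eq_mul] using congrFun h2 s
    exact funext fun k => Fintype.linearIndependent_iff.1 hb q h3 k
  · -- isotropy: `Q_{h,11}(v_k, v_l) = (b_kᵀ GG b_l) • Ω = 0`
    intro k l
    have h1 : polarizationPairingOne B.X h 11 (v k) (v l) =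
        ((∑ s, ∑ s', b k s * GG s s' * b l s' : ℚ) : ℂ) • Ω := by
      rw [hv, bilin_sum_smul_sum_smul]
      simp only [hGG, smul_smul, Rat.cast_sum, Rat.cast_mul, Finset.sum_smul]
      refine Finset.sum_congr rfl fun i _ => Finset.sum_congr rfl fun j _ => ?_
      ring_nf
    rw [h1, hbG, Rat.cast_zero, zero_smul]

end Summit.HodgeConjecture.HodgeConjecture.Theorems.WeilSixfoldsSqrtMinus7.RealQuadraticBaseChange

end
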